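import Summits.BirchSwinnertonDyer.BirchSwinnertonDyer.Theorems.GoldfeldAllTwistsTwoConverseTwinQuarterTraceIndexB4SevenModEightModFourUnion
import Summits.BirchSwinnertonDyer.BirchSwinnertonDyer.Theorems.GoldfeldAllTwistsTwoConverseTwinQuarterTraceIndexB4PlusAlphaSharp
import HarnessLib

set_option linter.dupNamespace false -- namespace `…BirchSwinnertonDyer.BirchSwinnertonDyer…` is the cell's (D-0017 nested layout)
set_option autoImplicit false

/-!
# OBJECT U⁺ (RULING (cccxcii)), file U⁺-F: the `(p/q)`-FREE FORMULA-AXIS CAPSTONE on the type-α `q ≡ 7 (mod 8)` two-prime family —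
# `BSD(W, 2)` on C4 ∪ C7A ∪ a71+ ∪ a75+ from EIGHTEEN named inputs, NO `hpq` binder, NO Cassels–Tate

Cell `bsd-goldfeld`, seat `bsd-goldfeld-s1p-c3x` (gen 16); planner RULING (cccxcii) (1) «GO ON OBJECT U⁺ AS PLANNED» (planner width, named in (cccxci)
CARRIES (f)). `--supports stmt-BirchSwinnertonDyer-19140 --as helper`. Theses-free; ONE theorem by cases, nothing else; 0 def, 0 new fact, no `sorry`.

THE UNION. On the α sub-family {`q` prime, `q > 3`, `q ≡ 7 (mod 8)`, `(q/7) = −1`} × {`p` prime, `p ≡ 1 (mod 4)`, `(−7/p) = +1`, `−7 ∉ 𝔽_p^{×4}`} and every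
globally minimal `W ≅ X₀(49)^{(−2qp)}`: `(p/q) = ±1` (`p ≠ q`); at `(p/q) = −1` U2 `bsdp_two_negTwoPrimesTwist_sevenModEight_modFour_of_print` (OBJECT U,
p682166; TYPE-FREE) and at `(p/q) = +1` F⁺-3 `bsdp_two_negTwoPrimesTwist_alphaPlus_modFour_of_print_sharp` (OBJECT A7⁺, p701492) give **`BSD(W, 2)`** — by
name, one case split. BINDERS = U2's EIGHTEEN {`hCST hGZ h12 h44 h13 h14 hS31 hnew hM hBT hBF hGZK hEta hEta₀ hD hBCST hpar hKo`} LETTER-IDENTICAL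
(union-by-name; `h13` is U2's pass-through only — no new `h13`- or `hCT`-consuming declaration; NO `hCT`), cell binders = U2's ∪ {`hα`} ∖ {`hpq`}.
HONEST FRAMING: `(p/q)`-free on the α sub-family ONLY; type β at `(p/q) = +1` is NOT covered (b71+ = second descent, director width; b75+ ⊂ B5⁺, offered,
unordered at writing); a twist-density-ZERO two-parameter family modulo the eighteen named inputs (SELMER-DRIFT ceiling (ccclxxxi)); FRONTIER-grade, never
distance-to-summit; twin″ (item 19140) and items 19350 / 20044 unchanged and NOT closed; BSD is not proved by any of this.

References: [Miller2011LMS] Def. 1.1; [GrossZagier1986] I.(6.3), V.§2; [Gross1984] §§4–5; [CoatesLiTianZhai2015] Thm 1.2–1.4, 4.4; [LiMa2008] Thm 0.4;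
[BurungaleCastellaSkinnerTian2022] Thm A, Rem. D; [SilvermanAEC2009] X.4.14.
-/

noncomputable section

open scoped Classical

open WeierstrassCurve NumberField Literature.NumberTheory Literature.NumberTheory.EllipticCurves
  Literature.NumberTheory.EllipticCurves.ModularForms Literature.NumberTheory.EllipticCurves.CaiShuTian2014
  Literature.NumberTheory.EllipticCurves.CoatesLiTianZhai2015

namespace Summit.BirchSwinnertonDyer.BirchSwinnertonDyer.Theorems.GoldfeldGoodTwists

section Union

variable (hCST : thm11_ringClassChar)
  (hGZ : ∀ (N : ℕ) [NeZero N] (W : WeierstrassCurve ℚ) (K : Type) [Field K] [NumberField K], gross_zagier N W K)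
  (h12 : thm12_fullBSD_twist) (h44 : thm44_ord_two_LAlg) (h13 : thm13_ord_two_LAlg) (h14 : thm14_rankOne_twist)
  (hS31 : bsdTriple_of_rank_le_one_of_conductor_lt) (hnew : exists_isNewformOf) (hM : OptimalCurveManinCertificate cm7)
  (hBT : burungaleTian_analyticRank_eq_zero_of_selmerCorank_eq_zero_of_hasCM) (hBF : bsdTriple_of_hasCM_of_L_one_ne_zero)
  (hGZK : rank_eq_analyticRank_of_analyticRank_le_one) (hEta : x049_heegner_norm_x_sub_two_not_mem)
  (hEta₀ : x049_x_sub_two_eq_etaQuotient) (hD : deuring_etaQuotient49_heegner_generates_conjPrime)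
  (hBCST : BurungaleCastellaSkinnerTian2022.thmA_analyticRank_eq_one_of_selmerCorank_eq_one)
  (hpar : ∀ (V : WeierstrassCurve ℚ) [V.IsElliptic], p_parity V 2)
  (hKo : ∀ (N : ℕ) [NeZero N] (W : WeierstrassCurve ℚ) (K : Type) [Field K] [NumberField K], kolyvagin N W K)
include hCST hGZ h12 h44 h13 h14 hS31 hnew hM hBT hBF hGZK hEta hEta₀ hD hBCST hpar hKo

/-- **`BSD(W, 2)` on the type-α `q ≡ 7 (mod 8)` two-prime family, WHATEVER `(p/q)` — FROM PRINT + KOLYVAGIN, NO Cassels–Tate.** `q > 3` prime,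
`q ≡ 7 (mod 8)`, `(q/7) = −1`; `p ≡ 1 (mod 4)` prime, `(−7/p) = +1`, `−7` NOT a fourth power mod `p`; NO `(p/q)` binder; `W/ℚ` globally minimal elliptic
with `C • W = X₀(49)^{(−2qp)}` for some `C`: **`BSD(W, 2)`** — by cases on `jacobiSym p q = ±1` onto U2
`bsdp_two_negTwoPrimesTwist_sevenModEight_modFour_of_print` (`(p/q) = −1`) ∣ F⁺-3 `bsdp_two_negTwoPrimesTwist_alphaPlus_modFour_of_print_sharp`
(`(p/q) = +1`). EIGHTEEN named inputs (U2's, by name), nothing else. With U⁺-R: `BSD(W, 2) ∧ r_an(W) = rank W(ℚ) = 1` for EVERY such `W` — modulo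
eighteen named prints; a density-zero two-parameter family; type β at `(p/q) = +1` NOT covered; FRONTIER-grade; items unchanged; BSD is not proved by any
of this. [cite: Miller2011LMS, Def. 1.1] [cite: GrossZagier1986, Thm. I.(6.3) and V.§2] [cite: CoatesLiTianZhai2015, Thm. 1.2 (p. 359), 1.4 and 4.4]
[cite: LiMa2008, Thm. 0.4] [cite: BurungaleCastellaSkinnerTian2022, Thm. A (p. 326) and Rem. D (p. 327)] [cite: SilvermanAEC2009, Thm. X.4.14] -/
theorem bsdp_two_negTwoPrimesTwist_sevenModEightAlpha_modFour_symbolFree_of_print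
    {q p : ℕ} (hq : q.Prime) (h3 : 3 < q) (hq8 : q % 8 = 7) (hq7 : jacobiSym q 7 = -1)
    [Fact p.Prime] (hp4 : p % 4 = 1) (hp7 : legendreSym p (-7) = 1) (hα : ¬ ∃ x : ZMod p, x ^ 4 = -7)
    (W : WeierstrassCurve ℚ) [W.IsElliptic] [W.IsGloballyMinimal]
    (hC : ∃ C : VariableChange ℚ, C • W = cm7.quadraticTwist (-(2 * (q : ℚ) * p))) : BSDp W 2 := by
  have hp : p.Prime := Fact.out
  have hne : p ≠ q := by rintro rfl; omega
  have hgcd : Int.gcd (p : ℤ) q = 1 := by rw [Int.gcd_natCast_natCast]; exact (Nat.coprime_primes hp hq).mpr hne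
  rcases jacobiSym.eq_one_or_neg_one hgcd with hpq | hpq
  · obtain ⟨C, hC⟩ := hC
    exact bsdp_two_negTwoPrimesTwist_alphaPlus_modFour_of_print_sharp hCST hGZ h12 h44 h14 hS31 hnew hM hBT hBF hGZK hEta hEta₀ hD hBCST hpar hKo hq
      hq8 hq7 hp4 hp7 hα hpq W C hC
  · exact bsdp_two_negTwoPrimesTwist_sevenModEight_modFour_of_print hCST hGZ h12 h44 h13 h14 hS31 hnew hM hBT hBF hGZK hEta hEta₀ hD hBCST hpar hKo hq
      h3 hq8 hq7 hp4 hp7 hpq W hC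

end Union

end Summit.BirchSwinnertonDyer.BirchSwinnertonDyer.Theorems.GoldfeldGoodTwists

end
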